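import Literature.Computability.Complexity.BrickAlgebra
import Literature.Computability.Complexity.FoldBricks
import HarnessLib

/-!
# An integer square-root brick in the `FP` algebra

Toolkit (`Computability/Complexity`, brick algebra of `BrickAlgebra.lean`, `StackBricks*.lean`,
`FoldBricks.lean`): the string function `isqrtFn w = ⟨⌊√|w|⌋⟩₂` — the integer square root of the
LENGTH of the input, in binary — is in `FP` (`isqrtFn_mem_FP`, `isqrtFn_apply`). It is the linear
search `t ↦ t + 1 while (t + 1)² ≤ |w|`, run for `|w|` rounds by the clocked-iteration lemma
`iterate_mem_FP_of_growth` on the record `⟨w, ⟨t⟩₂⟩` (the input itself is the fuel; the state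
grows by at most one bit per round). A numeral `⟨N⟩₂` with `N ≤ |r|` for a ruler `r` at hand is
first converted to `1ᴺ` by `binToUnaryFn` (`FPStringBricks.lean`), so `⌊√N⌋` of such bounded
numerals is available too (`isqrtFn (binToUnaryFn ⟨r, ⟨N⟩₂⟩)`, see `isqrtFn_binToUnaryFn`).

Used by `Literature/Barriers/PneNP/TardosFunctionFP.lean` (recovering the number of vertices `n`
from the `n²` adjacency bits, and Tardos's threshold `⌊√n⌋`).

## References

* S. Arora, B. Barak, *Computational Complexity: A Modern Approach*, CUP 2009, §1.3 (polynomial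
  time is closed under composition and bounded loops) [AroraBarakCC2009].
-/

namespace Literature.Computability.Complexity

open _root_.Computability Polynomial HashBricks OracleCompose

namespace Brick

/-! ### The search step -/

/-- One round of the square-root search with target `N`: advance `t` while `(t+1)² ≤ N`.
[folklore] -/
def sqrtStep (N t : ℕ) : ℕ := if (t + 1) * (t + 1) ≤ N then t + 1 else t

/-- After `j` rounds from `0` the search sits at `min j ⌊√N⌋`. [folklore] -/
theorem sqrtStep_iterate (N j : ℕ) : (sqrtStep N)^[j] 0 = min j (Nat.sqrt N) := by
  induction j with
  | zero => simp
  | succ j ih =>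
    rw [Function.iterate_succ_apply', ih, sqrtStep]
    by_cases hj : j < Nat.sqrt N
    · rw [min_eq_left hj.le, if_pos, min_eq_left (by omega)]
      calc (j + 1) * (j + 1) ≤ Nat.sqrt N * Nat.sqrt N := Nat.mul_self_le_mul_self (by omega)
        _ ≤ N := Nat.sqrt_le N
    · rw [not_lt] at hj
      rw [min_eq_right hj, if_neg, min_eq_right (by omega)]
      exact not_le.2 (Nat.lt_succ_sqrt N)

/-- The round function on records `⟨w, ⟨t⟩₂⟩ ↦ ⟨w, ⟨sqrtStep |w| t⟩₂⟩` (total: the components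
are read through `boolUnpair`, the numeral through `bitsToNat`). [folklore] -/
def sqrtRound (z : List Bool) : List Bool :=
  boolPair (fstF z) (encodeNat (sqrtStep (fstF z).length (bitsToNat (sndF z))))

/-- `sqrtRound` on a record. [folklore] -/
theorem sqrtRound_boolPair (w : List Bool) (t : ℕ) :
    sqrtRound (boolPair w (encodeNat t)) = boolPair w (encodeNat (sqrtStep w.length t)) := by
  simp [sqrtRound]

/-- Iterating the round function runs the search. [folklore] -/
theorem sqrtRound_iterate (w : List Bool) (j : ℕ) :
    sqrtRound^[j] (boolPair w (encodeNat 0)) = boolPair w (encodeNat ((sqrtStep w.length)^[j] 0)) := by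
  induction j with
  | zero => rfl
  | succ j ih => rw [Function.iterate_succ_apply', ih, sqrtRound_boolPair, Function.iterate_succ_apply']

/-- The successor of the state numeral: `z ↦ ⟨t + 1⟩₂`. [folklore] -/
noncomputable def succSnd : List Bool → List Bool := addFn ∘ fanoutFn sndF (fun _ => encodeNat 1)

/-- Value of `succSnd`. [folklore] -/
@[simp] theorem succSnd_apply (z : List Bool) : succSnd z = encodeNat (bitsToNat (sndF z) + 1) := by
  simp [succSnd]

/-- `succSnd ∈ FP`. [folklore] -/
theorem succSnd_mem_FP : succSnd ∈ FP :=
  comp_mem_FP addFn_mem_FP (fanoutFn_mem_FP sndF_mem_FP (const_mem_FP _))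

/-- The normalised state numeral: `z ↦ ⟨t⟩₂`. [folklore] -/
noncomputable def normSnd : List Bool → List Bool := addFn ∘ fanoutFn sndF (fun _ => [])

/-- Value of `normSnd`. [folklore] -/
@[simp] theorem normSnd_apply (z : List Bool) : normSnd z = encodeNat (bitsToNat (sndF z)) := by
  simp [normSnd]

/-- `normSnd ∈ FP`. [folklore] -/
theorem normSnd_mem_FP : normSnd ∈ FP :=
  comp_mem_FP addFn_mem_FP (fanoutFn_mem_FP sndF_mem_FP (const_mem_FP _))

/-- The loop test `[(t+1)² ≤ |w|]`, one bit. [folklore] -/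
noncomputable def sqrtTest : List Bool → List Bool :=
  notFn (ltFn ∘ fanoutFn (lenBinF ∘ fstF) (prodFn ∘ fanoutFn succSnd succSnd))

/-- Value of `sqrtTest`. [folklore] -/
theorem sqrtTest_apply (z : List Bool) :
    sqrtTest z = [decide ((bitsToNat (sndF z) + 1) * (bitsToNat (sndF z) + 1) ≤ (fstF z).length)] := by
  rw [sqrtTest, notFn_apply (b := decide ((fstF z).length <
      (bitsToNat (sndF z) + 1) * (bitsToNat (sndF z) + 1)))]
  · congr 1
    rw [← decide_not]
    exact decide_eq_decide.2 not_lt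
  · simp

/-- `sqrtTest ∈ FP`. [folklore] -/
theorem sqrtTest_mem_FP : sqrtTest ∈ FP :=
  notFn_mem_FP (comp_mem_FP ltFn_mem_FP (fanoutFn_mem_FP (comp_mem_FP lenBinF_mem_FP fstF_mem_FP)
    (comp_mem_FP prodFn_mem_FP (fanoutFn_mem_FP succSnd_mem_FP succSnd_mem_FP))))

/-- The round function as a brick expression. [folklore] -/
theorem sqrtRound_eq : sqrtRound = fanoutFn fstF (iteFn sqrtTest succSnd normSnd) := by
  funext z
  rw [fanoutFn_apply, iteFn_apply (sqrtTest_apply z), sqrtRound, sqrtStep]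
  simp only [decide_eq_true_eq, succSnd_apply, normSnd_apply]
  split_ifs <;> rfl

/-- `sqrtRound ∈ FP`. [folklore] -/
theorem sqrtRound_mem_FP : sqrtRound ∈ FP := by
  rw [sqrtRound_eq]
  exact fanoutFn_mem_FP fstF_mem_FP (iteFn_mem_FP sqrtTest_mem_FP succSnd_mem_FP normSnd_mem_FP)

/-- The round function keeps the first field. [folklore] -/
theorem fst_sqrtRound (z : List Bool) : (boolUnpair (sqrtRound z)).1 = (boolUnpair z).1 := by
  simp [sqrtRound, fstF]

/-- The round function grows the record by at most one symbol beyond `⟨fst, snd⟩`: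
`|sqrtRound z| ≤ |z| + 3`. [folklore] -/
theorem length_sqrtRound_le (z : List Bool) : (sqrtRound z).length ≤ z.length + 3 := by
  have h1 := length_fstF_sndF_le z
  have h2 : (encodeNat (sqrtStep (fstF z).length (bitsToNat (sndF z)))).length ≤
      (sndF z).length + 1 := by
    have ha := length_encodeNat_bitsToNat_le (sndF z)
    have hb := length_encodeNat_succ_le (bitsToNat (sndF z))
    unfold sqrtStep
    split_ifs
    · omega
    · omega
  simp only [sqrtRound, length_boolPair]
  omega

/-! ### The brick -/

/-- **The integer square root of the input length, in binary**: `isqrtFn w = ⟨⌊√|w|⌋⟩₂`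
(`isqrtFn_apply`), computed by `|w|` rounds of `sqrtRound` from `⟨w, ⟨0⟩₂⟩`. [folklore] -/
noncomputable def isqrtFn : List Bool → List Bool :=
  sndF ∘ (fun z => sqrtRound^[(X : ℕ[X]).eval (boolUnpair z).1.length] z) ∘ fanoutFn id (fun _ => [])

/-- **`isqrtFn ∈ FP`** (a clocked loop of linear growth, `iterate_mem_FP_of_growth`).
[cite: AroraBarakCC2009, §1.3] -/
theorem isqrtFn_mem_FP : isqrtFn ∈ FP :=
  comp_mem_FP sndF_mem_FP (comp_mem_FP
    (iterate_mem_FP_of_growth sqrtRound_mem_FP 3 fst_sqrtRound (fun z => by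
      have := length_sqrtRound_le z; nlinarith) X)
    (fanoutFn_mem_FP id_mem_FP (const_mem_FP _)))

/-- **Value of `isqrtFn`**: the integer square root of the length. [folklore] -/
@[simp] theorem isqrtFn_apply (w : List Bool) : isqrtFn w = encodeNat (Nat.sqrt w.length) := by
  have h0 : ([] : List Bool) = encodeNat 0 := rfl
  simp only [isqrtFn, Function.comp_apply, fanoutFn_apply, id, boolUnpair_boolPair, eval_X]
  rw [h0, sqrtRound_iterate, sndF_boolPair, sqrtStep_iterate, min_eq_right (Nat.sqrt_le_self _)]

/-- Square roots of bounded numerals: for `N ≤ |r|`, `isqrtFn (binToUnaryFn ⟨r, ⟨N⟩₂⟩) = ⟨⌊√N⌋⟩₂`.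
[folklore] -/
theorem isqrtFn_binToUnaryFn (r : List Bool) {N : ℕ} (hN : N ≤ r.length) :
    isqrtFn (binToUnaryFn (boolPair r (encodeNat N))) = encodeNat (Nat.sqrt N) := by
  rw [binToUnaryFn_boolPair, bitsToNat_encodeNat, min_eq_left hN, isqrtFn_apply]
  simp [ones]

end Brick

end Literature.Computability.Complexity
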